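import Summits.RiemannHypothesis.RiemannHypothesis.Theses.LaguerreSpeiserSplit

/-!
# Line `birth` — birth skeleton for crux `LaguerreOnLine` (stmt-RiemannHypothesis-18897)

Route `LaguerreSpeiserSplit` (route-RiemannHypothesis-LaguerreSpeiserSplit), crux #3 (the imported
near-field complement). Crux (route decl, verbatim): the STRICT Laguerre inequality on the whole
real axis for Riemann's `Ξ` (`Ξ = Literature.NumberTheory.LFunctions.riemannXiUpper`,
`Ξℝ t = Re Ξ(t)`):

  `∀ t : ℝ, 0 < (Ξℝ)′(t)² − Ξℝ(t) · (Ξℝ)″(t)`   (`L₁(t) > 0`; Csordas, arXiv:1309.0055, OP 4.7).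

## The cut (planner skeleton registrar, 2026-08-17): OFF-ZERO SLOPE × SIMPLICITY ON THE LINE

The route header's own reading of the crux — "exactly `(Ξ′/Ξ)′ < 0` off the real zeros ∧ every real
zero of `Ξ` is simple" — typed as two registered stubs and a sorry-free seam:

* stub **SLOPE** `stub_logDerivSlope` (open; RH-implied): at every real `t` with `Ξ(t) ≠ 0`,
  `L₁(t) > 0`, i.e. `(Ξ′/Ξ)′(t) = −L₁(t)/Ξ(t)² < 0`: the logarithmic derivative of `Ξ` is strictly
  decreasing between consecutive real zeros. Under RH it is `−(Ξ′/Ξ)′(t) = Σ_γ m(γ)/(t − γ)² > 0`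
  (Mittag-Leffler expansion over the zeros `γ ∈ ℝ`; in the tree the local form of that expansion is
  the Titchmarsh engine `Literature.Analysis.Complex.titchmarsh_logDeriv_sub_sum`). Unconditionally a
  conjugate pair of zeros `c ± id` of `Ξ` contributes `−2m((t − c)² − d²)/|t − c − id|⁴`, of the wrong
  sign exactly on `|t − c| < |d|`, so SLOPE says: no off-line pair sits closer to the line than the
  positive mass `Σ_γ (t − γ)⁻²` of the real zeros can absorb (the "near field" of the route's
  dichotomy). It is strictly weaker IN FORM than RH (an off-line pair with `d` large against the
  local spacing `2π/log c` does not violate it) and it does not see multiplicities of real zeros at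
  all. Known regime: `|t| ≤ H − 1/2` whenever RH is verified to height `H` (every zero `w` with
  `|Re w − t| < 1/2 ≥ |Im w|` is then real, so every term of the expansion is positive): with
  `Literature.NumberTheory.DiophantineGeometry.riemannHypothesisUpTo_platt_trudgian` (named fact,
  `H = 3 000 175 332 800`) this is the window; the tail `|t| > H − 1/2` is the open content.
  Size: open-problem (tail) + M (window, from the named fact and the Mittag-Leffler expansion).
* stub **SIMPLE** `stub_simpleOnLine` (open): every REAL zero of `Ξ` is simple — `Ξ(t) = 0 ⇒
  Ξ′(t) ≠ 0` for real `t`; equivalently every zero of `ζ` ON the critical line is simple (the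
  factor `½ s(s − 1) π^{−s/2} Γ(s/2)` does not vanish there). Known: a positive proportion
  (Levinson 1974; Conrey 1989: ≥ 40.1 % of the zeros are simple and on the line; Bui–Heath-Brown
  2013: ≥ 70.37 % of the zeros are simple assuming RH), and every zero in the ranges where the
  sign-change verifications ISOLATE the zeros (van de Lune–te Riele–Winter 1986: the first
  1.5·10⁹ zeros are simple and on the line; Platt 2017, rigorous isolation to height 3.06·10¹⁰).
  Size: open-problem.

Seam `LaguerreOnLine_of` (sorry-free, below): fix `t : ℝ`. If `Ξ(t) ≠ 0`, SLOPE. If `Ξ(t) = 0`,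
then `Ξℝ(t) = 0`, so `L₁(t) = (Ξℝ)′(t)²`; and `(Ξℝ)′(t) = Re Ξ′(t)`
(`Literature.Analysis.Complex.KiKim.hasDerivAt_re_ofReal`) with `Im Ξ′(t) = 0`
(`Literature.Analysis.Complex.im_deriv_ofReal`, `Ξ` being real on `ℝ`:
`Literature.NumberTheory.LFunctions.im_riemannXiUpper_ofReal_holds`), so SIMPLE gives
`Re Ξ′(t) ≠ 0` and `L₁(t) > 0`. `LaguerreOnLine_proof : LaguerreOnLine` is the skeleton theorem
concluding the crux BY NAME from the two registered stubs (sorry only inside `stub_*`).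

Neither stub is the crux or the summit reworded: SLOPE is blind at the real zeros (it holds for
`Ξ²`-type functions with double real zeros, where the crux fails), SIMPLE is blind off them (it holds
for real entire functions with simple real zeros and non-real pairs hugging the line, where the crux
fails); the crux is their conjunction and each is implied by it (calibration examples below).
BC3 probes (planner folder `bc/stub_probes.lean`): `stub → LaguerreOnLine` and
`stub → Summit.RiemannHypothesis` by `first | exact? | simpa | … | aesop` fail for both stubs (log in
`Lines/birth.md`).

Disproof used: none on file (`Cruxes/LaguerreOnLine/` had no workfiles before this line: no
`Disproof.lean`, no landed `Theorems/LaguerreOnLine/Negative/*`); negatives index of the summit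
(CharacterSums Conrey-positivity, UniversalFactor Laplace loophole) untouched by either stub.
-/

set_option linter.dupNamespace false

noncomputable section

namespace Summit.RiemannHypothesis.RiemannHypothesis.Cruxes.LaguerreOnLine.Birth

open Literature.NumberTheory.LFunctions (riemannXiUpper riemannXi differentiable_riemannXi
  im_riemannXiUpper_ofReal_holds)
open Summit.RiemannHypothesis.RiemannHypothesis.Theses.LaguerreSpeiserSplit (LaguerreOnLine)

/-! ### Registered stubs (`sorry` lives only here) -/

/-- **Stub SLOPE (`LogDerivSlope`).** Off the real zeros of `Ξ` the strict Laguerre inequality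
holds: for real `t` with `Ξ(t) ≠ 0`, `(Ξℝ)′(t)² − Ξℝ(t)·(Ξℝ)″(t) > 0`, i.e. `(Ξ′/Ξ)′(t) < 0` — the
logarithmic derivative of `Ξ` is strictly decreasing between consecutive real zeros. RH-implied
(`−(Ξ′/Ξ)′(t) = Σ_γ m(γ)(t − γ)⁻² > 0`); unconditionally it excludes off-line pairs `c ± id` closer
to the line than the real-zero mass `Σ_γ (t − γ)⁻²` absorbs (near field). Known for
`|t| ≤ H − 1/2` under RH-to-height-`H` (`riemannHypothesisUpTo_platt_trudgian`). Size: open-problem. -/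
theorem stub_logDerivSlope :
    ∀ t : ℝ, riemannXiUpper (t : ℂ) ≠ 0 →
      0 < deriv (fun u : ℝ => (riemannXiUpper (u : ℂ)).re) t ^ 2
        - (riemannXiUpper (t : ℂ)).re * iteratedDeriv 2 (fun u : ℝ => (riemannXiUpper (u : ℂ)).re) t := by
  sorry

/-- **Stub SIMPLE (`SimpleOnLine`).** Every real zero of `Ξ` is simple: `Ξ(t) = 0 ⇒ Ξ′(t) ≠ 0`
for real `t` (equivalently: every zero of `ζ` on the critical line is simple). Known for a positive
proportion of the zeros (Levinson 1974, Conrey 1989, Bui–Heath-Brown 2013) and for every zero in the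
ranges where the sign-change verifications isolate the zeros (van de Lune–te Riele–Winter 1986,
Platt 2017). Size: open-problem. -/
theorem stub_simpleOnLine :
    ∀ t : ℝ, riemannXiUpper (t : ℂ) = 0 → deriv riemannXiUpper (t : ℂ) ≠ 0 := by
  sorry

/-! ### Stub statements as named propositions

The `abbrev`s below are the stubs' exact elaborated types (`type_of%`), so `LaguerreOnLine_of` takes
`(h : Statement.stub_<name>)` and nothing else (tree convention, cf.
`Cruxes/HereditaryLaguerre/Lines/birth.lean`). -/

namespace Statement

/-- Statement of `stub_logDerivSlope`. -/
abbrev stub_logDerivSlope : Prop := type_of% @Birth.stub_logDerivSlope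
/-- Statement of `stub_simpleOnLine`. -/
abbrev stub_simpleOnLine : Prop := type_of% @Birth.stub_simpleOnLine

end Statement

/-! ### Composition (sorry-free) and the skeleton theorem -/

/-- `Ξ` is entire (composition of `ξ` with the affine map `z ↦ 1/2 + i z`). [folklore] -/
theorem differentiable_riemannXiUpper : Differentiable ℂ riemannXiUpper := by
  have h : riemannXiUpper = fun z => riemannXi (1 / 2 + Complex.I * z) := rfl
  rw [h]
  exact differentiable_riemannXi.comp
    ((differentiable_const _).add ((differentiable_const _).mul differentiable_id))

/-- **Composition.** SLOPE and SIMPLE imply the crux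
`Summit.RiemannHypothesis.RiemannHypothesis.Theses.LaguerreSpeiserSplit.LaguerreOnLine` BY NAME:
off the real zeros SLOPE is the claim; at a real zero `t`, `L₁(t) = (Re Ξ′(t))²` with `Ξ′(t)` real
(`im_deriv_ofReal`) and non-zero (SIMPLE). -/
theorem LaguerreOnLine_of (hSlope : Statement.stub_logDerivSlope)
    (hSimple : Statement.stub_simpleOnLine) : LaguerreOnLine := by
  intro t
  by_cases hz : riemannXiUpper (t : ℂ) = 0
  · -- at a real zero: `L₁(t) = (Re Ξ′(t))²`, and `Ξ′(t)` is real and non-zero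
    have hderiv : deriv (fun u : ℝ => (riemannXiUpper (u : ℂ)).re) t
        = (deriv riemannXiUpper (t : ℂ)).re :=
      (Literature.Analysis.Complex.KiKim.hasDerivAt_re_ofReal
        (differentiable_riemannXiUpper.differentiableAt)).deriv
    have him : (deriv riemannXiUpper (t : ℂ)).im = 0 :=
      Literature.Analysis.Complex.im_deriv_ofReal differentiable_riemannXiUpper
        (fun x => im_riemannXiUpper_ofReal_holds x) t
    have hre : (deriv riemannXiUpper (t : ℂ)).re ≠ 0 := by
      intro h0
      exact hSimple t hz (Complex.ext (by simpa using h0) (by simpa using him))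
    have hz' : (riemannXiUpper (t : ℂ)).re = 0 := by rw [hz, Complex.zero_re]
    rw [hz', zero_mul, sub_zero, hderiv]
    exact lt_of_le_of_ne (sq_nonneg _) (Ne.symm (pow_ne_zero 2 hre))
  · exact hSlope t hz

/-- **The skeleton**: the crux BY NAME from the two registered stubs (depends on `sorryAx` only
through `stub_*`). -/
theorem LaguerreOnLine_proof : LaguerreOnLine :=
  LaguerreOnLine_of stub_logDerivSlope stub_simpleOnLine

/-! ### Calibration (sorry-free): each stub is implied by the crux, so the cut loses no strength -/

/-- The crux gives SLOPE (drop the hypothesis) and SIMPLE (at a real zero the crux reads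
`(Re Ξ′(t))² > 0`). -/
example (h : LaguerreOnLine) : Statement.stub_logDerivSlope ∧ Statement.stub_simpleOnLine := by
  refine ⟨fun t _ => h t, fun t hz hd => ?_⟩
  have ht := h t
  have hderiv : deriv (fun u : ℝ => (riemannXiUpper (u : ℂ)).re) t
      = (deriv riemannXiUpper (t : ℂ)).re :=
    (Literature.Analysis.Complex.KiKim.hasDerivAt_re_ofReal
      (differentiable_riemannXiUpper.differentiableAt)).deriv
  have hz' : (riemannXiUpper (t : ℂ)).re = 0 := by rw [hz, Complex.zero_re]
  rw [hz', zero_mul, sub_zero, hderiv, hd, Complex.zero_re] at ht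
  norm_num at ht

end Summit.RiemannHypothesis.RiemannHypothesis.Cruxes.LaguerreOnLine.Birth
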